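import Summits.Ventures.HSemireg.WedgeWeilPurityLocus

/-!
# Venture HSemireg — the Weil-frame purity locus in invariant form: ab = ½·I₂(q)

HONEST FRAMING. Part of the Lean index of the computation cell `pub-hsemireg` (second enclosure wave, cut by seat p6 in the
conventions of seat p3's ENCLOSURE-PLAN-p3.md / build.py from th-7's kernel assets).  Finite-dimensional exterior algebra over a field ONLY:
no variety, no cohomology theory, no semiregularity map is constructed here; nothing here says that HC / HC_CM / HC_AV holds;
no Literature fact is declared or used.  The geometric DICTIONARY (why these ranks are the `HT`-side box ranks of the cell's
STRUCTURE.md §1 / theory/FORMULA-N.md) lives in theory/FORMULA-N-th7.md PART B §A.3 / §N and is NOT asserted in Lean.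

th-7's PART E — THE PURITY LOCUS IN INVARIANT FORM (theory/th7/WeilPurity.lean v3.2 sha256/16 fa4f1543e639b652 (th-7 g5, 22:21Z 2026-08-22; ×2 farm rc 0 + axioms standard at p3 g9 21:58Z (v3.1 prefix), th-2 g22 22:27Z, p6 g7 22:32Z; statement reads + independent exact numerics p6 g6 X2-WEILPURITY-p6g6.md a0873432c5a1b400 (PART W 105/105, PART D 704/704) and p6 g7 X2-WEILPURITY-E-p6g7.md 6348f244af71037e (PART E 216/216)), l.6996–7075), VERBATIM up to namespaces (as in
`WedgeWeilPurityLocus.lean`): the apolar self-pairing `I2 n q = Σ_{k=0}^{2n} (−1)^k C(2n,k) q_k q_{2n−k}` (twice the quadratic invariant of the binary `2n`-ic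
`Σ C(2n,k) q_k s^{2n−k}t^k`), `alt_sum_choose`, `alt_binomial`, **`I2_two_exp`**: `I2(c₁λ^• + c₂μ^•) = 2·c₁c₂(λ−μ)^{2n}` (`n ≥ 1`), and
**`weilPurity_invariant`** (every `n ≥ 1`, characteristic `≠ 2`, `c₁c₂ab ≠ 0`, `λ ≠ μ`): `finrank range(θ ↦ θ ∧ vW ∣ ⋀ⁿ) + 4 + 2·[2ab = I2 n q] = 4·C(2n,n)`
for the two-exponential `q` — the locus of `weilPurity_vW` read on `q` alone («`ab = ½ I₂(q)`»; FORMULA-N PART B §L.5 [v1.7zv]; the general-`q` statement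
is th-7's CONJECTURE W-PURITY(ρ), NOT this theorem).  ×2: th-2 g22 22:27Z, p6 g7 X2-WEILPURITY-E-p6g7.md (2 negative controls, numerics 216/216).
-/

/-! ## PART E — THE PURITY LOCUS IN INVARIANT FORM (th-7 g5, 2026-08-22).
For the two-exponential h-part `q_k = c₁λ^k + c₂μ^k` the purity value `c₁c₂(λ−μ)^{2n}` is HALF THE APOLAR
SELF-PAIRING `I₂(q) := Σ_k (−1)^k C(2n,k) q_k q_{2n−k}` of the sequence `q` — the quadratic invariant of the binary
`2n`-ic with coefficients `C(2n,k) q_k`. Hence `weilPurity_vW` reads, intrinsically in `q`: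
`finrank + 4 + 2·[2ab = I₂(q)] = 4·C(2n,n)` (characteristic ≠ 2). FORMULA-N PART B §L.5 [v1.7zv]. -/

namespace Summit.Ventures.HSemireg.Wedge.WeilPurity

open Module Finset Summit.Ventures.HSemireg.Wedge.Weil
open Summit.Ventures.HSemireg.Wedge.Hankel hiding Φ isoQ Φ_ι

variable (K : Type*) [Field K] (n : ℕ)

/-- the apolar self-pairing `Σ_{k=0}^{2n} (−1)^k C(2n,k) q_k q_{2n−k}` (twice the quadratic invariant). -/
def I2 (q : ℕ → K) : K :=
  ∑ k ∈ range (2 * n + 1), (-1 : K) ^ k * ((2 * n).choose k : K) * (q k * q (2 * n - k))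

/-- `Σ_k (−1)^k C(2n,k) = 0` for `n ≥ 1` (from `(−1 + 1)^{2n} = 0`). -/
lemma alt_sum_choose (hn : 0 < n) :
    ∑ k ∈ range (2 * n + 1), (-1 : K) ^ k * ((2 * n).choose k : K) = 0 := by
  have h := add_pow (-1 : K) 1 (2 * n)
  rw [neg_add_cancel, zero_pow (by omega : 2 * n ≠ 0)] at h
  rw [h]
  refine sum_congr rfl fun k _ => ?_
  rw [one_pow, mul_one]

/-- `Σ_k (−1)^k C(2n,k) x^k y^{2n−k} = (y − x)^{2n}`. -/
lemma alt_binomial (x y : K) :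
    ∑ k ∈ range (2 * n + 1), (-1 : K) ^ k * ((2 * n).choose k : K) * (x ^ k * y ^ (2 * n - k)) =
      (y - x) ^ (2 * n) := by
  rw [sub_eq_neg_add, add_pow]
  refine sum_congr rfl fun k _ => ?_
  rw [neg_pow x k]
  ring

/-- **the two-exponential value of the apolar pairing:** `I₂(c₁λ^• + c₂μ^•) = 2·c₁c₂(λ−μ)^{2n}` (`n ≥ 1`). -/
theorem I2_two_exp (hn : 0 < n) (c₁ c₂ lam mu : K) :
    I2 K n (fun k => c₁ * lam ^ k + c₂ * mu ^ k) = 2 * (c₁ * c₂ * (lam - mu) ^ (2 * n)) := by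
  have hsplit : ∀ k ∈ range (2 * n + 1),
      (-1 : K) ^ k * ((2 * n).choose k : K) *
          ((c₁ * lam ^ k + c₂ * mu ^ k) * (c₁ * lam ^ (2 * n - k) + c₂ * mu ^ (2 * n - k))) =
        c₁ ^ 2 * lam ^ (2 * n) * ((-1 : K) ^ k * ((2 * n).choose k : K)) +
        c₂ ^ 2 * mu ^ (2 * n) * ((-1 : K) ^ k * ((2 * n).choose k : K)) +
        c₁ * c₂ * ((-1 : K) ^ k * ((2 * n).choose k : K) * (lam ^ k * mu ^ (2 * n - k))) +
        c₁ * c₂ * ((-1 : K) ^ k * ((2 * n).choose k : K) * (mu ^ k * lam ^ (2 * n - k))) := by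
    intro k hk
    have hk' : k ≤ 2 * n := Nat.lt_succ_iff.mp (mem_range.mp hk)
    have hl : lam ^ k * lam ^ (2 * n - k) = lam ^ (2 * n) := by rw [← pow_add, Nat.add_sub_cancel' hk']
    have hm : mu ^ k * mu ^ (2 * n - k) = mu ^ (2 * n) := by rw [← pow_add, Nat.add_sub_cancel' hk']
    have e : (c₁ * lam ^ k + c₂ * mu ^ k) * (c₁ * lam ^ (2 * n - k) + c₂ * mu ^ (2 * n - k)) =
        c₁ ^ 2 * (lam ^ k * lam ^ (2 * n - k)) + c₂ ^ 2 * (mu ^ k * mu ^ (2 * n - k)) +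
          c₁ * c₂ * (lam ^ k * mu ^ (2 * n - k)) + c₁ * c₂ * (mu ^ k * lam ^ (2 * n - k)) := by ring
    rw [e, hl, hm]
    ring
  rw [I2, sum_congr rfl hsplit, sum_add_distrib, sum_add_distrib, sum_add_distrib, ← mul_sum, ← mul_sum,
    ← mul_sum, ← mul_sum, alt_sum_choose K n hn, alt_binomial, alt_binomial, mul_zero, mul_zero, zero_add,
    zero_add]
  have hev : (mu - lam) ^ (2 * n) = (lam - mu) ^ (2 * n) := by
    rw [← neg_sub lam mu, neg_pow, pow_mul, neg_one_sq, one_pow, one_mul]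
  rw [hev]
  ring

open Classical in
/-- **THE WEIL-FRAME PURITY LOCUS IN INVARIANT FORM** (every `n ≥ 1`, every field of characteristic `≠ 2`):
for `v = vW (q_k = c₁λ^k + c₂μ^k) a b` of type `(n,n)` with `c₁c₂ab ≠ 0`, `λ ≠ μ`,
`finrank range(θ ↦ θ ∧ v ∣ ⋀ⁿ) + 4 + 2·[2ab = I₂(q)] = 4·C(2n,n)` — the locus is «`ab` = the quadratic invariant
`½ I₂(q)` of the binary `2n`-ic», stated on `q` alone. -/
theorem weilPurity_invariant (hn : 0 < n) (htwo : (2 : K) ≠ 0) {c₁ c₂ lam mu a b : K} (h1 : c₁ ≠ 0)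
    (h2 : c₂ ≠ 0) (hlm : lam ≠ mu) (ha : a ≠ 0) (hb : b ≠ 0) :
    Module.finrank K (LinearMap.range (wedge K (n + n) n (vW K (n + n) n (fun k => c₁ * lam ^ k + c₂ * mu ^ k) a b)))
      + 4 + 2 * (if 2 * (a * b) = I2 K n (fun k => c₁ * lam ^ k + c₂ * mu ^ k) then 1 else 0) =
      4 * (n + n).choose n := by
  have h := weilPurity_vW K (n := n) hn h1 h2 hlm ha hb
  have hiff : (2 * (a * b) = I2 K n (fun k => c₁ * lam ^ k + c₂ * mu ^ k)) ↔
      (a * b = c₁ * c₂ * (lam - mu) ^ (2 * n)) := by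
    rw [I2_two_exp K n hn]
    exact ⟨fun e => mul_left_cancel₀ htwo e, fun e => by rw [e]⟩
  simp only [hiff]
  exact h

end Summit.Ventures.HSemireg.Wedge.WeilPurity
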